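import Mathlib
import Summits.Ventures.PercRepro2.Defs
import Summits.Ventures.PercRepro2.Independence
import Summits.Ventures.PercRepro2.Harris
import Summits.Ventures.PercRepro2.Graph
import Summits.Ventures.PercRepro2.Events
import Summits.Ventures.PercRepro2.BHKEvents
import Summits.Ventures.PercRepro2.RProduct
import Summits.Ventures.PercRepro2.RootCutSupport
import Summits.Ventures.PercRepro2.CutSepDefs

/-!
# The L-half of the weighted (PM) across a cut vertex, same-side placement (blind cell PercRepro2,
mine-2 g20; proofs/MINE2-CUTU.md Theorem 1 + Theorem 3, M2-42)

The host `u` is a cut vertex separating the roots with `o, b` on `a₁`'s side: sides `VL ∋ a₁, o, b` and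
`VH ∋ a₂` meeting only in `u` (`CutSame`; third components of `H − u` may be merged into either side).  The far
side enters only through the event `B = {u ↔ a₂ in VH}` (independent of every `VL`-event): this is the
PINNING of Theorem 1, and the proof of `LeafRootPM.halfL_nonneg` (the leaf subclass, `B = {e₀ open}`) goes
through verbatim with `β = P(B)`:

  `(1 − t_u) · HALF_L = β · [ P(Q)² · C_ū + (1 − β) · C_bu · ((1 − β) · C_ou + β (1 − t_u) x_o) ]`

(`C_ū ≥ 0` by BHK 1.3 for the cluster of `a₁` given `a₁ ↮ u`, read inside `VL`; `C_bu, C_ou ≥ 0` Harris).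
**Theorem `halfL_same_nonneg`**: the cleared L-half ≥ 0 on the class.  Typed version: not claimed.
-/

namespace Summit.Ventures.PercRepro2

namespace CutSamePM

open CovForm.RootBridge CutMixedPM

section Class

variable {V : Type*} {E : Type*}

/-- **The host `u` is a cut vertex separating the roots, same-side placement**: sides `VL ∋ a₁, o, b` and
`VH ∋ a₂` meeting only in `u`; every edge lies within one side, none within both. -/
structure CutSame (ends : E → Sym2 V) (a₁ o b a₂ u : V) (VL VH : Set V) : Prop where
  split : ∀ e, e ∈ within ends VL ∨ e ∈ within ends VH
  cap : ∀ t, t ∈ VL → t ∈ VH → t = u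
  noloop : ∀ e, ¬ (e ∈ within ends VL ∧ e ∈ within ends VH)
  uL : u ∈ VL
  uH : u ∈ VH
  a1L : a₁ ∈ VL
  oL : o ∈ VL
  bL : b ∈ VL
  a2H : a₂ ∈ VH
  a1u : a₁ ≠ u
  ou : o ≠ u
  bu : b ≠ u
  a2u : a₂ ≠ u

variable {ends : E → Sym2 V} {a₁ o b a₂ u : V} {VL VH : Set V}

/-- A connection inside `VL` between two vertices of `VL` is read in the restriction. -/
lemma connEvent_eq_CW_L (hc : CutSame ends a₁ o b a₂ u VL VH) {x y : V} (hx : x ∈ VL) (hy : y ∈ VL) :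
    connEvent ends x y = CW ends VL x y := by
  ext ω
  simp only [mem_connEvent, CW, Set.mem_setOf_eq]
  exact conn_side ends (fun e _ => hc.split e) hc.cap hx hy

/-- A connection from `VL` to `VH ∖ {u}` passes through `u`. -/
lemma connEvent_eq_cross_LH (hc : CutSame ends a₁ o b a₂ u VL VH) {x y : V} (hx : x ∈ VL) (hy : y ∈ VH)
    (hyu : y ≠ u) : connEvent ends x y = CW ends VL x u ∩ CW ends VH u y := by
  ext ω
  simp only [mem_connEvent, Set.mem_inter_iff, CW, Set.mem_setOf_eq]
  exact conn_cross ends (fun e _ => hc.split e) hc.cap ⟨hc.uL, hc.uH⟩ hx hy hyu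

/-- A connection from `VH` to `VL ∖ {u}` passes through `u`. -/
lemma connEvent_eq_cross_HL (hc : CutSame ends a₁ o b a₂ u VL VH) {x y : V} (hx : x ∈ VH) (hy : y ∈ VL)
    (hyu : y ≠ u) : connEvent ends x y = CW ends VH x u ∩ CW ends VL u y := by
  ext ω
  simp only [mem_connEvent, Set.mem_inter_iff, CW, Set.mem_setOf_eq]
  exact conn_cross ends (fun e he => (hc.split e).symm) (fun t h1 h2 => hc.cap t h2 h1)
    ⟨hc.uH, hc.uL⟩ hx hy hyu

/-- The two sides carry disjoint edge sets. -/
lemma disjoint_within (hc : CutSame ends a₁ o b a₂ u VL VH) :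
    Disjoint (within ends VL) (within ends VH) :=
  Set.disjoint_left.2 fun e h1 h2 => hc.noloop e ⟨h1, h2⟩

end Class


section Extra

variable {V : Type*} {E : Type*} {ends : E → Sym2 V} {a₁ o b a₂ u : V} {VL VH : Set V}

/-- `{a₂ ↔ u}` is read inside `VH`. -/
lemma connEvent_eq_CW_H' (hc : CutSame ends a₁ o b a₂ u VL VH) :
    connEvent ends a₂ u = CW ends VH a₂ u := by
  ext ω
  simp only [mem_connEvent, CW, Set.mem_setOf_eq]
  exact conn_side ends (fun e he => (hc.split e).symm) (fun t h1 h2 => hc.cap t h2 h1) hc.a2H hc.uH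

end Extra

section SetAlgebra

variable {X : Type*}

/-- Set algebra: `Lb ∩ (O ∩ A) = (Lb ∩ A) ∩ O`. -/
lemma set_d1 (Lb O A : Set X) : Lb ∩ (O ∩ A) = (Lb ∩ A) ∩ O := by
  ext ω; simp only [Set.mem_inter_iff]; tauto

/-- Set algebra: `O ∩ (O ∩ A)ᶜ = Aᶜ ∩ O`. -/
lemma set_d2 (O A : Set X) : O ∩ (O ∩ A)ᶜ = Aᶜ ∩ O := by
  ext ω; simp only [Set.mem_inter_iff, Set.mem_compl_iff]; tauto

/-- Set algebra: `Lb ∩ O ∩ (O ∩ A)ᶜ = (Lb ∩ Aᶜ) ∩ O`. -/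
lemma set_d3 (Lb O A : Set X) : Lb ∩ O ∩ (O ∩ A)ᶜ = (Lb ∩ Aᶜ) ∩ O := by
  ext ω; simp only [Set.mem_inter_iff, Set.mem_compl_iff]; tauto

/-- Set algebra: `O ∩ Xo ∩ (O ∩ A)ᶜ = (Xo ∩ Aᶜ) ∩ O`. -/
lemma set_d4 (Xo O A : Set X) : O ∩ Xo ∩ (O ∩ A)ᶜ = (Xo ∩ Aᶜ) ∩ O := by
  ext ω; simp only [Set.mem_inter_iff, Set.mem_compl_iff]; tauto

/-- Set algebra: `Lb ∩ (O ∩ Xo) ∩ (O ∩ A)ᶜ = (Lb ∩ Xo ∩ Aᶜ) ∩ O`. -/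
lemma set_d5 (Lb Xo O A : Set X) : Lb ∩ (O ∩ Xo) ∩ (O ∩ A)ᶜ = (Lb ∩ Xo ∩ Aᶜ) ∩ O := by
  ext ω; simp only [Set.mem_inter_iff, Set.mem_compl_iff]; tauto

/-- Set algebra: `(Lo ∪ O ∩ Xo) ∩ (O ∩ A)ᶜ = (Lo ∩ (O ∩ A)ᶜ) ∪ ((Xo ∩ Aᶜ) ∩ O)`. -/
lemma set_d6 (Lo Xo O A : Set X) :
    (Lo ∪ O ∩ Xo) ∩ (O ∩ A)ᶜ = (Lo ∩ (O ∩ A)ᶜ) ∪ ((Xo ∩ Aᶜ) ∩ O) := by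
  ext ω; simp only [Set.mem_inter_iff, Set.mem_compl_iff, Set.mem_union]; tauto

/-- Set algebra: `O ∩ (Lo ∪ O ∩ Xo) ∩ (O ∩ A)ᶜ = ((Lo ∪ Xo) ∩ Aᶜ) ∩ O`. -/
lemma set_d7 (Lo Xo O A : Set X) : O ∩ (Lo ∪ O ∩ Xo) ∩ (O ∩ A)ᶜ = ((Lo ∪ Xo) ∩ Aᶜ) ∩ O := by
  ext ω; simp only [Set.mem_inter_iff, Set.mem_compl_iff, Set.mem_union]; tauto

/-- Set algebra: `Lb ∩ O ∩ (Lo ∪ O ∩ Xo) ∩ (O ∩ A)ᶜ = (Lb ∩ (Lo ∪ Xo) ∩ Aᶜ) ∩ O`. -/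
lemma set_d8 (Lb Lo Xo O A : Set X) :
    Lb ∩ O ∩ (Lo ∪ O ∩ Xo) ∩ (O ∩ A)ᶜ = (Lb ∩ (Lo ∪ Xo) ∩ Aᶜ) ∩ O := by
  ext ω; simp only [Set.mem_inter_iff, Set.mem_compl_iff, Set.mem_union]; tauto

/-- Set algebra: `(Lo ∪ Xo) ∩ Aᶜ = (Lo ∩ Aᶜ) ∪ (Xo ∩ Aᶜ)`. -/
lemma set_union_inter (Lo Xo A : Set X) : (Lo ∪ Xo) ∩ Aᶜ = (Lo ∩ Aᶜ) ∪ (Xo ∩ Aᶜ) := by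
  ext ω; simp only [Set.mem_inter_iff, Set.mem_compl_iff, Set.mem_union]; tauto

/-- Set algebra: `Lb ∩ (Lo ∪ Xo) ∩ Aᶜ = (Lb ∩ Lo ∩ Aᶜ) ∪ (Lb ∩ Xo ∩ Aᶜ)`. -/
lemma set_union_inter' (Lb Lo Xo A : Set X) :
    Lb ∩ (Lo ∪ Xo) ∩ Aᶜ = (Lb ∩ Lo ∩ Aᶜ) ∪ (Lb ∩ Xo ∩ Aᶜ) := by
  ext ω; simp only [Set.mem_inter_iff, Set.mem_compl_iff, Set.mem_union]; tauto

end SetAlgebra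

section Main

variable {V : Type*} {E : Type*} [Fintype E] [DecidableEq E] [Fintype V] [DecidableEq V]
  {R : Type*} [CommRing R] [LinearOrder R] [IsStrictOrderedRing R]

/-- **The L-half of the weighted (PM) is nonnegative when the host `u` is a cut vertex separating the
roots with `o, b` on `a₁`'s side** (proofs/MINE2-CUTU.md Theorems 1 + 3): with `Q = {a₁ ↮ a₂}`,
`L_b = {a₁ ↔ b}`, `H_u = {a₂ ↔ u}`, `H_o = {a₂ ↔ o}`, `oU = {a₁ ↔ o} ∪ {a₂ ↔ o}`,
`0 ≤ P(Q)·[P(Q) P(L_b H_u oU Q) − P(L_b Q) P(H_u oU Q)] − P(oU Q)·[P(Q) P(L_b H_u Q) − P(L_b Q) P(H_u Q)]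
      − P(Q)·[P(Q) P(L_b H_o Q) − P(L_b Q) P(H_o Q)]`. -/
theorem halfL_same_nonneg (p : E → R) (hp : IsProbVec p) (ends : E → Sym2 V) (o a₁ a₂ b u : V)
    {VL VH : Set V} (hc : CutSame ends a₁ o b a₂ u VL VH) :
    0 ≤ prob p (connEvent ends a₁ a₂)ᶜ *
          (prob p (connEvent ends a₁ a₂)ᶜ *
              prob p (connEvent ends a₁ b ∩ connEvent ends a₂ u ∩
                (connEvent ends a₁ o ∪ connEvent ends a₂ o) ∩ (connEvent ends a₁ a₂)ᶜ) -
            prob p (connEvent ends a₁ b ∩ (connEvent ends a₁ a₂)ᶜ) *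
              prob p (connEvent ends a₂ u ∩ (connEvent ends a₁ o ∪ connEvent ends a₂ o) ∩
                (connEvent ends a₁ a₂)ᶜ)) -
        prob p ((connEvent ends a₁ o ∪ connEvent ends a₂ o) ∩ (connEvent ends a₁ a₂)ᶜ) *
          (prob p (connEvent ends a₁ a₂)ᶜ *
              prob p (connEvent ends a₁ b ∩ connEvent ends a₂ u ∩ (connEvent ends a₁ a₂)ᶜ) -
            prob p (connEvent ends a₁ b ∩ (connEvent ends a₁ a₂)ᶜ) *
              prob p (connEvent ends a₂ u ∩ (connEvent ends a₁ a₂)ᶜ)) -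
        prob p (connEvent ends a₁ a₂)ᶜ *
          (prob p (connEvent ends a₁ a₂)ᶜ *
              prob p (connEvent ends a₁ b ∩ connEvent ends a₂ o ∩ (connEvent ends a₁ a₂)ᶜ) -
            prob p (connEvent ends a₁ b ∩ (connEvent ends a₁ a₂)ᶜ) *
              prob p (connEvent ends a₂ o ∩ (connEvent ends a₁ a₂)ᶜ)) := by
  -- the cut-vertex dictionary for the events
  have hQ : connEvent ends a₁ a₂ = CW ends VH u a₂ ∩ CW ends VL a₁ u := by
    rw [connEvent_eq_cross_LH hc hc.a1L hc.a2H hc.a2u, Set.inter_comm]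
  have hHu : connEvent ends a₂ u = CW ends VH u a₂ := by
    rw [connEvent_eq_CW_H' hc, CW_comm]
  have hHo : connEvent ends a₂ o = CW ends VH u a₂ ∩ CW ends VL u o := by
    rw [connEvent_eq_cross_HL hc hc.a2H hc.oL hc.ou, CW_comm (ends := ends) a₂ u]
  have hLb : connEvent ends a₁ b = CW ends VL a₁ b := connEvent_eq_CW_L hc hc.a1L hc.bL
  have hLo : connEvent ends a₁ o = CW ends VL a₁ o := connEvent_eq_CW_L hc hc.a1L hc.oL
  have hA' : connEvent ends a₁ u = CW ends VL a₁ u := connEvent_eq_CW_L hc hc.a1L hc.uL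
  rw [hQ, hHu, hHo, hLb, hLo]
  -- names
  set A := CW ends VL a₁ u with hA
  set O := CW ends VH u a₂ with hO
  set Lb := CW ends VL a₁ b with hLb'
  set Lo := CW ends VL a₁ o with hLo'
  set Xo := CW ends VL u o with hXo
  -- `VL`-events and the far-side event `O`
  have hdis := disjoint_within hc
  have dA : DependsOn (· ∈ A) (within ends VL) := dependsOn_CW a₁ u
  have dLb : DependsOn (· ∈ Lb) (within ends VL) := dependsOn_CW a₁ b
  have dLo : DependsOn (· ∈ Lo) (within ends VL) := dependsOn_CW a₁ o
  have dXo : DependsOn (· ∈ Xo) (within ends VL) := dependsOn_CW u o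
  have dO : DependsOn (· ∈ O) (within ends VH) := dependsOn_CW u a₂
  have dAc : DependsOn (· ∈ Aᶜ) (within ends VL) := dependsOn_compl dA
  have prob_inter_openEdge_of_dependsOn : ∀ {X : Set (Config E)}, DependsOn (· ∈ X) (within ends VL) →
      prob p (X ∩ O) = prob p X * prob p O :=
    fun hX => prob_inter_eq_mul_of_dependsOn p hdis hX dO
  -- `a₁ ↔ o` and `u ↔ o` force `a₁ ↔ u`
  have hLoXo : Lo ∩ Xo ⊆ A := CW_inter_subset a₁ o u
  have hdisj1 : Disjoint (Lo ∩ (O ∩ A)ᶜ) ((Xo ∩ Aᶜ) ∩ O) := by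
    rw [Set.disjoint_left]
    rintro ω ⟨hLo', hc⟩ ⟨⟨hXo', hA'⟩, hO'⟩
    exact hA' (hLoXo ⟨hLo', hXo'⟩)
  have hdisj2 : Disjoint (Lo ∩ Aᶜ) (Xo ∩ Aᶜ) := by
    rw [Set.disjoint_left]
    rintro ω ⟨hLo', hA'⟩ ⟨hXo', _⟩
    exact hA' (hLoXo ⟨hLo', hXo'⟩)
  have hdisj3 : Disjoint (Lb ∩ Lo ∩ Aᶜ) (Lb ∩ Xo ∩ Aᶜ) := by
    rw [Set.disjoint_left]
    rintro ω ⟨⟨_, hLo'⟩, hA'⟩ ⟨⟨_, hXo'⟩, _⟩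
    exact hA' (hLoXo ⟨hLo', hXo'⟩)
  -- the masses
  have hβ0 : 0 ≤ prob p O := prob_nonneg hp O
  have hβ1 : prob p O ≤ 1 := prob_le_one hp O
  have htu1 : prob p A ≤ 1 := prob_le_one hp A
  have hAc : prob p Aᶜ = 1 - prob p A := prob_compl p A
  have hsplit_b : prob p (Lb ∩ A) + prob p (Lb ∩ Aᶜ) = prob p Lb :=
    prob_inter_add_prob_inter_compl p Lb A
  have hsplit_o : prob p (Lo ∩ A) + prob p (Lo ∩ Aᶜ) = prob p Lo :=
    prob_inter_add_prob_inter_compl p Lo A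
  -- dictionary
  have d0 : prob p (O ∩ A)ᶜ = 1 - prob p A * prob p O := by
    rw [prob_compl, Set.inter_comm, prob_inter_openEdge_of_dependsOn dA]
  have d1 : prob p (Lb ∩ (O ∩ A)ᶜ) = prob p Lb - prob p (Lb ∩ A) * prob p O := by
    have := prob_inter_add_prob_inter_compl p Lb (O ∩ A)
    rw [set_d1, prob_inter_openEdge_of_dependsOn (depI dLb dA)] at this
    linarith
  have d1o : prob p (Lo ∩ (O ∩ A)ᶜ) = prob p Lo - prob p (Lo ∩ A) * prob p O := by
    have := prob_inter_add_prob_inter_compl p Lo (O ∩ A)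
    rw [set_d1, prob_inter_openEdge_of_dependsOn (depI dLo dA)] at this
    linarith
  have d2 : prob p (O ∩ (O ∩ A)ᶜ) = (1 - prob p A) * prob p O := by
    rw [set_d2, prob_inter_openEdge_of_dependsOn dAc, hAc]
  have d3 : prob p (Lb ∩ O ∩ (O ∩ A)ᶜ) = prob p (Lb ∩ Aᶜ) * prob p O := by
    rw [set_d3, prob_inter_openEdge_of_dependsOn (depI dLb dAc)]
  have d4 : prob p (O ∩ Xo ∩ (O ∩ A)ᶜ) = prob p (Xo ∩ Aᶜ) * prob p O := by
    rw [set_d4, prob_inter_openEdge_of_dependsOn (depI dXo dAc)]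
  have d5 : prob p (Lb ∩ (O ∩ Xo) ∩ (O ∩ A)ᶜ) = prob p (Lb ∩ Xo ∩ Aᶜ) * prob p O := by
    rw [set_d5, prob_inter_openEdge_of_dependsOn (depI (depI dLb dXo) dAc)]
  have d6 : prob p ((Lo ∪ O ∩ Xo) ∩ (O ∩ A)ᶜ) =
      (prob p Lo - prob p (Lo ∩ A) * prob p O) + prob p (Xo ∩ Aᶜ) * prob p O := by
    rw [set_d6, prob_union_of_disjoint p hdisj1, d1o,
      prob_inter_openEdge_of_dependsOn (depI dXo dAc)]
  have d7 : prob p (O ∩ (Lo ∪ O ∩ Xo) ∩ (O ∩ A)ᶜ) =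
      (prob p (Lo ∩ Aᶜ) + prob p (Xo ∩ Aᶜ)) * prob p O := by
    rw [set_d7, prob_inter_openEdge_of_dependsOn (depI (depU dLo dXo) dAc),
      set_union_inter, prob_union_of_disjoint p hdisj2]
  have d8 : prob p (Lb ∩ O ∩ (Lo ∪ O ∩ Xo) ∩ (O ∩ A)ᶜ) =
      (prob p (Lb ∩ Lo ∩ Aᶜ) + prob p (Lb ∩ Xo ∩ Aᶜ)) * prob p O := by
    rw [set_d8, prob_inter_openEdge_of_dependsOn
      (depI (depI dLb (depU dLo dXo)) dAc),
      set_union_inter', prob_union_of_disjoint p hdisj3]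
  rw [d0, d1, d2, d3, d4, d5, d6, d7, d8]
  clear d0 d1 d1o d2 d3 d4 d5 d6 d7 d8 hdisj1 hdisj2 hdisj3
  -- the three correlation inequalities, read inside `VL`
  have hBHK := bhk_same_cluster_events p hp ends a₁ u (𝓤 := {W : Set V | b ∈ W})
    (𝓥 := {W : Set V | o ∈ W}) (fun _ _ h hW => h hW) (fun _ _ h hW => h hW)
  rw [RProduct.clusterInEvent_mem_eq, RProduct.clusterInEvent_mem_eq, hLb, hLo, hA'] at hBHK
  have hHarris_b := prob_mul_prob_le_prob_inter hp (isUpperSet_CW (ends := ends) (W := VL) a₁ b)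
    (isUpperSet_CW (ends := ends) (W := VL) a₁ u)
  have hHarris_o := prob_mul_prob_le_prob_inter hp (isUpperSet_CW (ends := ends) (W := VL) a₁ o)
    (isUpperSet_CW (ends := ends) (W := VL) a₁ u)
  -- nonnegativity and bounds of the masses
  have hxo := prob_nonneg hp (Xo ∩ Aᶜ)
  have hmb := prob_nonneg hp (Lb ∩ Aᶜ)
  have hmo := prob_nonneg hp (Lo ∩ Aᶜ)
  have hmbo := prob_nonneg hp (Lb ∩ Lo ∩ Aᶜ)
  have hybo := prob_nonneg hp (Lb ∩ Xo ∩ Aᶜ)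
  have hkbu := prob_nonneg hp (Lb ∩ A)
  have hkou := prob_nonneg hp (Lo ∩ A)
  have htu0 := prob_nonneg hp A
  have hmb_le : prob p (Lb ∩ Aᶜ) ≤ prob p Aᶜ := prob_mono hp Set.inter_subset_right
  have hmo_le : prob p (Lo ∩ Aᶜ) ≤ prob p Aᶜ := prob_mono hp Set.inter_subset_right
  have hmbo_le : prob p (Lb ∩ Lo ∩ Aᶜ) ≤ prob p Aᶜ := prob_mono hp Set.inter_subset_right
  have hxo_le : prob p (Xo ∩ Aᶜ) ≤ prob p Aᶜ := prob_mono hp Set.inter_subset_right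
  have hybo_le : prob p (Lb ∩ Xo ∩ Aᶜ) ≤ prob p Aᶜ := prob_mono hp Set.inter_subset_right
  rw [← hsplit_b, ← hsplit_o]
  rw [← hsplit_b] at hHarris_b
  rw [← hsplit_o] at hHarris_o
  clear hsplit_b hsplit_o dA dLb dLo dXo dAc dO hLoXo prob_inter_openEdge_of_dependsOn
  generalize hβ : prob p O = β at *
  generalize htu : prob p A = tu at *
  generalize hac : prob p Aᶜ = ac at *
  generalize hkbu' : prob p (Lb ∩ A) = kbu at *
  generalize hmb' : prob p (Lb ∩ Aᶜ) = mb at *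
  generalize hkou' : prob p (Lo ∩ A) = kou at *
  generalize hmo' : prob p (Lo ∩ Aᶜ) = mo at *
  generalize hmbo' : prob p (Lb ∩ Lo ∩ Aᶜ) = mbo at *
  generalize hxo' : prob p (Xo ∩ Aᶜ) = xo at *
  generalize hybo' : prob p (Lb ∩ Xo ∩ Aᶜ) = ybo at *
  clear hβ htu hac hkbu' hmb' hkou' hmo' hmbo' hxo' hybo' hQ hHu hHo hLb hLo hA' hc hdis
  subst hAc
  have hCu : 0 ≤ mbo * (1 - tu) - mb * mo := by linarith only [hBHK]
  have hCb : 0 ≤ kbu - tu * (kbu + mb) := by linarith only [hHarris_b]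
  have hCo : 0 ≤ kou - tu * (kou + mo) := by linarith only [hHarris_o]
  -- the key identity
  have key : (1 - tu) *
      ((1 - tu * β) * ((1 - tu * β) * ((mbo + ybo) * β) - (kbu + mb - kbu * β) * ((mo + xo) * β)) -
        (kou + mo - kou * β + xo * β) *
          ((1 - tu * β) * (mb * β) - (kbu + mb - kbu * β) * ((1 - tu) * β)) -
        (1 - tu * β) * ((1 - tu * β) * (ybo * β) - (kbu + mb - kbu * β) * (xo * β))) =
      β * ((1 - tu * β) * (1 - tu * β) * (mbo * (1 - tu) - mb * mo) +
        (1 - β) * (kbu - tu * (kbu + mb)) *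
          ((1 - β) * (kou - tu * (kou + mo)) + β * (1 - tu) * xo)) := by
    ring
  have h1β : 0 ≤ 1 - β := by linarith only [hβ1]
  have h1tu : 0 ≤ 1 - tu := by linarith only [htu1]
  have hRHS : 0 ≤ β * ((1 - tu * β) * (1 - tu * β) * (mbo * (1 - tu) - mb * mo) +
        (1 - β) * (kbu - tu * (kbu + mb)) *
          ((1 - β) * (kou - tu * (kou + mo)) + β * (1 - tu) * xo)) := by
    apply mul_nonneg hβ0
    apply add_nonneg
    · exact mul_nonneg (mul_self_nonneg _) hCu
    · apply mul_nonneg (mul_nonneg h1β hCb)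
      apply add_nonneg (mul_nonneg h1β hCo)
      exact mul_nonneg (mul_nonneg hβ0 h1tu) hxo
  rcases eq_or_lt_of_le h1tu with h | h
  · -- `t_u = 1`: every mass on `Aᶜ` vanishes
    have z1 : mb = 0 := le_antisymm (by linarith only [hmb_le, h]) hmb
    have z2 : mo = 0 := le_antisymm (by linarith only [hmo_le, h]) hmo
    have z3 : mbo = 0 := le_antisymm (by linarith only [hmbo_le, h]) hmbo
    have z4 : xo = 0 := le_antisymm (by linarith only [hxo_le, h]) hxo
    have z5 : ybo = 0 := le_antisymm (by linarith only [hybo_le, h]) hybo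
    have htu' : tu = 1 := by linarith only [h]
    rw [z1, z2, z3, z4, z5, htu']
    ring_nf
    exact le_refl _
  · exact (mul_nonneg_iff_of_pos_left h).mp (key ▸ hRHS)

end Main

end CutSamePM

end Summit.Ventures.PercRepro2
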